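import Literature.NumberTheory.Sieve.MatomakiRadziwill
import Mathlib.MeasureTheory.Function.Floor
import Mathlib.MeasureTheory.Integral.IntervalIntegral.Basic
import Mathlib.MeasureTheory.Integral.Bochner.Set
import Mathlib.Analysis.SpecialFunctions.Pow.Real
import Mathlib.Analysis.SpecialFunctions.Pow.Continuity
import HarnessLib

/-!
# Matomäki–Radziwiłł 2016: Theorem 3 from Lemma 14, Proposition 1 and Lemmas 4, 5 (§9, proved)

Topic `NumberTheory/Sieve`.  `MatomakiRadziwill.lean` vendors, as named facts, Theorem 3 of
Matomäki–Radziwiłł (`MatomakiRadziwill2016_theorem3`, the mean-square estimate on the sieved set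
`𝒮`), Proposition 1 (`MatomakiRadziwill2016_prop1`, the Dirichlet-polynomial bound), Lemma 14
(`MatomakiRadziwill2016_lemma14_real`, the Parseval bound, in its faithful real-sequence rendering)
and Lemma 4 (`MatomakiRadziwill2016_lemma4`, the Lipschitz estimate), and proves Lemma 5
(`MatomakiRadziwill2016_lemma5`).  This file **proves** the first deduction of §9 of the paper
("Proof of Theorem 3"):

* `MatomakiRadziwill2016_theorem3_of_prop1_real :
    MatomakiRadziwill2016_lemma14_real → MatomakiRadziwill2016_lemma4 →
    MatomakiRadziwill2016_prop1 → MatomakiRadziwill2016_theorem3`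

(and `MatomakiRadziwill2016_theorem3_of_prop1`, the same from the over-stated complex-sequence
rendering `MatomakiRadziwill2016_lemma14_parseval` — a vacuous implication since that rendering is
REFUTED, `MatomakiRadziwill2016_lemma14_parseval_false` in `MatomakiRadziwillLemma14Refutation.lean`,
and `@[deprecated]` since the 2026-08-15 verdict clean-up; the two theorems taking it as a hypothesis,
`MatomakiRadziwillThm3.theorem3_of_prop1` and `MatomakiRadziwill2016_theorem3_of_prop1`, are kept for
append-only reasons and are `@[deprecated]` in favour of the `_real` forms).

Composed with `MatomakiRadziwill2016_theorem1_of_theorem3` and `matomaki_radziwill_of_theorem3`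
(`MatomakiRadziwillTheorem1.lean`, Theorem 1 from Theorem 3; not imported here) this makes the
named-fact frontier below `Literature.NumberTheory.Sieve.matomaki_radziwill` (parity.S38) equal to {Lemma 14, Lemma 4,
Proposition 1}.

## The argument (§9, "Proof of Theorem 3") and its formal rendering

The paper: "Combining Lemma 14 with Proposition 1 it follows that
`X⁻¹ ∫_X^{2X} |h⁻¹ ∑_{x≤n≤x+h, n∈𝒮} f(n) - h₂⁻¹ ∑_{x≤n≤x+h₂, n∈𝒮} f(n)|² dx ≪ (log h)^{1/3}/P_1^{1/6-η} + (log X)^{-1/50}`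
when `Q_1 ≤ h ≤ h₂ = X/(log X)^{1/5}`.  Using Lemma 4 together with Lemma 5 we have, for any
`X ≤ x ≤ 2X`, `h₂⁻¹ ∑_{x≤n≤x+h₂, n∈𝒮} f(n) = X⁻¹ ∑_{X≤n≤2X, n∈𝒮} f(n) + O((log X)^{-1/20+o(1)})` (17),
and the claim follows in case `h ≤ h₂`. In case `h > h₂`, the claim follows immediately from (17)."

1. *(17)* (`lipschitz_sieved`): by Lemma 5, `∑_{n∈𝒮} f(n) = ∑_{𝒥 ⊆ [1,J]} (-1)^{#𝒥} ∑ g_𝒥(n) f(n)`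
   with `2^J` multiplicative `f g_𝒥 : ℕ → [-1,1]`, so Lemma 4 gives the Lipschitz bound with
   constant `M₄ = 2^J C₄ (log X)^{-1/20}`.  The "`(log X)^{o(1)}`" is made effective by
   `four_pow_J_le`: condition (3) of the interval system forces `log Q_j ≥ 48 j² log Q_{j-1}`, whence
   `4^J ≤ 4^{19} (log X)^{1/14}` from `Q_J ≤ exp(√log X)`, and `M₄² ≤ 4^{19} C₄² (log X)^{-1/35}`.
2. *Lemma 14* is applied to the real sequence `a_m = f(m) 1_𝒮(m) 1_{[X,2X]}(m)` (`abs_coeffR_le`),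
   whose Dirichlet polynomial over `[X, 4X]` is `F(1+it) = ∑_{X≤n≤2X, n∈𝒮} f(n) n^{-1-it}`
   (`sum_coeffR_mul`), with `h₁ = h`;
   Proposition 1 at `T = X/h` bounds `∫_{(log X)^{1/15}}^{X/h} |F|² ≤ 2 C_P (…)` (as `Q_1 ≤ h`) and at
   `T ↦ 2T` bounds each `(X/h)/T ∫_T^{2T} |F|² ≤ 3 C_P (…)` for `T ≥ X/h`, hence the `⨆`.
3. *Truncation at `2X`*: the window sums of `a_m` are the sieved sums with the window cut at `2X`;
   they agree with the untruncated ones unless `x > 2X - h_j - 1`, a set of measure `≤ h_j + 1 ≤ 2h₂`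
   on which the squared difference is `≤ 16` (`htrunc` in the proof), contributing
   `≪ h₂/X = (log X)^{-1/5}`.
4. *Assembly*: pointwise on `(X, 2X]`,
   `(h⁻¹S_h − B)² ≤ 4[(h⁻¹S_h − h⁻¹S'_h)² + (h⁻¹S'_h − h₂⁻¹S'_{h₂})² + (h₂⁻¹S'_{h₂} − h₂⁻¹S_{h₂})² + (h₂⁻¹S_{h₂} − B)²]`
   (`sq_add_four_le`), the four integrals being bounded by 3., Lemma 14 + Proposition 1, 3., and
   (17) respectively; every error exponent (`1/5, 2/15, 1/35`) is at least `1/50`.  For `h > h₂`,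
   (17) with `y = h ≤ X` bounds the integrand pointwise by `M₄²`.

The constant obtained is `C = 256 + 4|C₁₄| + 20|C₁₄||C_P| + 4^{20} C₄²` and
`X₀ = max(X₁₄, X₄, X_P, e)`.

## References

* K. Matomäki, M. Radziwiłł, *Multiplicative functions in short intervals*, Ann. of Math. (2)
  183 (2016), 1015–1056, doi:10.4007/annals.2016.183.3.6 (arXiv:1501.04585): §9, "Proof of
  Theorem 3" (arXiv p. 19), display (17); §2 conditions (2), (3); Lemmas 4, 5, 14, Proposition 1.

## Mathlib

Interval integrals (`intervalIntegral`, `integral_mono_of_nonneg`, `norm_integral_le_of_norm_le_const`),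
`Nat.measurable_ceil`/`Nat.measurable_floor` for the step functions, `Real.iSup_nonneg`/`ciSup_le`
for the `max` term.  One `set_option maxHeartbeats 1600000 in` (the final assembly is a single long
bookkeeping proof).
-/

noncomputable section

open Finset MeasureTheory Filter

namespace Literature.NumberTheory.Sieve

namespace MatomakiRadziwillThm3

variable {η X : ℝ}

/-! ### The number `J` of intervals is small: `4^J ≪ (log X)^{1/14}` from condition (3) -/

/-- Condition (3) forces `log Q_j ≥ (j²/η)(8 log Q_{j-1} + 16 log j)` for `j ≥ 2`. [folklore] -/
theorem logQ_succ_ge (I : SieveIntervalSystem η X) (hη : 0 < η) {j : ℕ} (hj : 2 ≤ j) :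
    (j : ℝ) ^ 2 / η * (8 * Real.log (I.Q (j - 1)) + 16 * Real.log j) ≤ Real.log (I.Q j) := by
  have h3 := I.notTooClose j hj
  have hj1 : 1 ≤ j := by omega
  have hPQ : Real.log (I.P j) ≤ Real.log (I.Q j) :=
    Real.log_le_log (I.pos_P j hj1) (I.P_le_Q j hj1)
  have hj0 : (0 : ℝ) < (j : ℝ) ^ 2 := by positivity
  have hc : 0 < η / (j : ℝ) ^ 2 := by positivity
  have h' : 8 * Real.log (I.Q (j - 1)) + 16 * Real.log j ≤ η / (j : ℝ) ^ 2 * Real.log (I.Q j) :=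
    h3.trans (mul_le_mul_of_nonneg_left hPQ hc.le)
  calc (j : ℝ) ^ 2 / η * (8 * Real.log (I.Q (j - 1)) + 16 * Real.log j)
      ≤ (j : ℝ) ^ 2 / η * (η / (j : ℝ) ^ 2 * Real.log (I.Q j)) :=
        mul_le_mul_of_nonneg_left h' (by positivity)
    _ = Real.log (I.Q j) := by field_simp

/-- `log Q_j ≥ 0` for all `j ≥ 1`. [folklore] -/
theorem logQ_nonneg (I : SieveIntervalSystem η X) (hη : 0 < η) {j : ℕ} (hj : 1 ≤ j) :
    0 ≤ Real.log (I.Q j) := by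
  induction j with
  | zero => omega
  | succ k ih =>
    rcases Nat.lt_or_ge k 1 with hk | hk
    · have : k = 0 := by omega
      subst this
      have h1 : 1 ≤ I.Q 1 := I.one_le_P_one.trans (I.P_le_Q 1 le_rfl)
      exact Real.log_nonneg h1
    · have hk2 : 2 ≤ k + 1 := by omega
      have h := logQ_succ_ge I hη hk2
      have ih' := ih hk
      simp only [Nat.add_sub_cancel] at h
      have hlogj : 0 ≤ Real.log ((k + 1 : ℕ) : ℝ) :=
        Real.log_nonneg (by exact_mod_cast (show 1 ≤ k + 1 by omega))
      have : 0 ≤ ((k + 1 : ℕ) : ℝ) ^ 2 / η * (8 * Real.log (I.Q k) + 16 * Real.log ((k + 1 : ℕ) : ℝ)) := by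
        positivity
      linarith

/-- For `η ≤ 1/6` and `j ≥ 19`: `log Q_j ≥ 4^7 log Q_{j-1}` (`48 · 19² ≥ 4^7`). [folklore] -/
theorem logQ_ge_mul (I : SieveIntervalSystem η X) (hη : 0 < η) (hη' : η ≤ 1 / 6) {j : ℕ} (hj : 19 ≤ j) :
    (4 : ℝ) ^ 7 * Real.log (I.Q (j - 1)) ≤ Real.log (I.Q j) := by
  have h := logQ_succ_ge I hη (show 2 ≤ j by omega)
  have hQ : 0 ≤ Real.log (I.Q (j - 1)) := logQ_nonneg I hη (by omega)
  have hlogj : 0 ≤ Real.log (j : ℝ) := Real.log_nonneg (by exact_mod_cast (show 1 ≤ j by omega))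
  have hj' : (19 : ℝ) ≤ j := by exact_mod_cast hj
  have hcoef : (4 : ℝ) ^ 7 ≤ (j : ℝ) ^ 2 / η * 8 := by
    rw [div_mul_eq_mul_div, le_div_iff₀ hη]
    nlinarith
  calc (4 : ℝ) ^ 7 * Real.log (I.Q (j - 1)) ≤ (j : ℝ) ^ 2 / η * 8 * Real.log (I.Q (j - 1)) :=
        mul_le_mul_of_nonneg_right hcoef hQ
    _ ≤ (j : ℝ) ^ 2 / η * (8 * Real.log (I.Q (j - 1)) + 16 * Real.log j) := by
        have : 0 ≤ (j : ℝ) ^ 2 / η * (16 * Real.log j) := by positivity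
        nlinarith
    _ ≤ Real.log (I.Q j) := h

/-- `log Q_19 ≥ 1`. [folklore] -/
theorem one_le_logQ (I : SieveIntervalSystem η X) (hη : 0 < η) (hη' : η ≤ 1 / 6) {j : ℕ} (hj : 19 ≤ j) :
    1 ≤ Real.log (I.Q j) := by
  have h := logQ_succ_ge I hη (show 2 ≤ j by omega)
  have hQ : 0 ≤ Real.log (I.Q (j - 1)) := logQ_nonneg I hη (by omega)
  have hj' : (19 : ℝ) ≤ j := by exact_mod_cast hj
  have hlogj : 1 ≤ Real.log (j : ℝ) := by
    rw [← Real.log_exp 1]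
    refine Real.log_le_log (Real.exp_pos 1) (le_trans ?_ hj')
    have := Real.exp_one_lt_d9
    norm_num at this ⊢
    linarith
  have hcoef : (1 : ℝ) ≤ (j : ℝ) ^ 2 / η * 16 := by
    rw [div_mul_eq_mul_div, le_div_iff₀ hη]
    nlinarith
  calc (1 : ℝ) ≤ (j : ℝ) ^ 2 / η * 16 := hcoef
    _ ≤ (j : ℝ) ^ 2 / η * 16 * Real.log j := le_mul_of_one_le_right (by positivity) hlogj
    _ ≤ (j : ℝ) ^ 2 / η * (8 * Real.log (I.Q (j - 1)) + 16 * Real.log j) := by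
        have : 0 ≤ (j : ℝ) ^ 2 / η * (8 * Real.log (I.Q (j - 1))) := by positivity
        nlinarith
    _ ≤ Real.log (I.Q j) := h

/-- `4^{7 (J - 19)} ≤ log Q_J` for `J ≥ 19`. [folklore] -/
theorem pow_le_logQ (I : SieveIntervalSystem η X) (hη : 0 < η) (hη' : η ≤ 1 / 6) {j : ℕ} (hj : 19 ≤ j) :
    ((4 : ℝ) ^ 7) ^ (j - 19) ≤ Real.log (I.Q j) := by
  induction j with
  | zero => omega
  | succ k ih =>
    rcases Nat.lt_or_ge k 19 with hk | hk
    · have : k = 18 := by omega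
      subst this
      simpa using one_le_logQ I hη hη' (le_refl 19)
    · have h := logQ_ge_mul I hη hη' (show 19 ≤ k + 1 by omega)
      simp only [Nat.add_sub_cancel] at h
      have : k + 1 - 19 = (k - 19) + 1 := by omega
      rw [this, pow_succ]
      calc ((4 : ℝ) ^ 7) ^ (k - 19) * 4 ^ 7 = 4 ^ 7 * ((4 : ℝ) ^ 7) ^ (k - 19) := by ring
        _ ≤ 4 ^ 7 * Real.log (I.Q k) := mul_le_mul_of_nonneg_left (ih hk) (by positivity)
        _ ≤ Real.log (I.Q (k + 1)) := h

/-- **`J` is small**: `4^J ≤ 4^19 (log X)^{1/14}` for any interval system with `0 < η ≤ 1/6` at a level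
`X` with `log X ≥ 1` (from (3): `log Q_j` grows faster than `48 j² log Q_{j-1}`, and
`Q_J ≤ exp(√log X)`).  This is the "`2^J ≪ (log X)^{o(1)}`" of §8.3 / §9 in effective form. [folklore] -/
theorem four_pow_J_le (I : SieveIntervalSystem η X) (hη : 0 < η) (hη' : η ≤ 1 / 6)
    (hX : 1 ≤ Real.log X) : (4 : ℝ) ^ I.J ≤ 4 ^ 19 * Real.log X ^ (1 / 14 : ℝ) := by
  have hlX : 0 < Real.log X := by linarith
  rcases Nat.lt_or_ge I.J 19 with hJ | hJ
  · calc (4 : ℝ) ^ I.J ≤ 4 ^ 19 := pow_le_pow_right₀ (by norm_num) hJ.le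
      _ = 4 ^ 19 * 1 := (mul_one _).symm
      _ ≤ 4 ^ 19 * Real.log X ^ (1 / 14 : ℝ) :=
          mul_le_mul_of_nonneg_left (Real.one_le_rpow hX (by norm_num)) (by positivity)
  · -- `4^{7(J-19)} ≤ log Q_J ≤ √log X`
    have h1 := pow_le_logQ I hη hη' hJ
    have h2 : Real.log (I.Q I.J) ≤ Real.sqrt (Real.log X) := by
      have := Real.log_le_log (I.pos_Q I.one_le_J) I.Q_J_le
      rwa [Real.log_exp] at this
    have h3 : ((4 : ℝ) ^ 7) ^ (I.J - 19) ≤ Real.log X ^ (1 / 2 : ℝ) := by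
      rw [← Real.sqrt_eq_rpow]; exact h1.trans h2
    -- take `1/7`-th powers
    have h4 : (4 : ℝ) ^ (I.J - 19) ≤ Real.log X ^ (1 / 14 : ℝ) := by
      have hl : (0 : ℝ) ≤ ((4 : ℝ) ^ 7) ^ (I.J - 19) := by positivity
      have h5 := Real.rpow_le_rpow hl h3 (show (0 : ℝ) ≤ 1 / 7 by norm_num)
      have hlhs : (((4 : ℝ) ^ 7) ^ (I.J - 19)) ^ (1 / 7 : ℝ) = (4 : ℝ) ^ (I.J - 19) := by
        rw [← pow_mul, mul_comm, pow_mul, ← Real.rpow_natCast (((4 : ℝ)) ^ (I.J - 19)) 7,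
          ← Real.rpow_mul (by positivity)]
        norm_num
      have hrhs : (Real.log X ^ (1 / 2 : ℝ)) ^ (1 / 7 : ℝ) = Real.log X ^ (1 / 14 : ℝ) := by
        rw [← Real.rpow_mul hlX.le]; norm_num
      rwa [hlhs, hrhs] at h5
    have : I.J = 19 + (I.J - 19) := by omega
    calc (4 : ℝ) ^ I.J = 4 ^ 19 * 4 ^ (I.J - 19) := by rw [this, pow_add]; simp
      _ ≤ 4 ^ 19 * Real.log X ^ (1 / 14 : ℝ) := mul_le_mul_of_nonneg_left h4 (by positivity)
/-! ### The Lipschitz estimate (17) for the sieved sums: Lemma 4 for each `f · g_𝒥`, and Lemma 5 -/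

/-- For `x ∈ [X, 2X]` and `X/(log X)^{1/5} ≤ y ≤ X`:
`|y⁻¹ ∑_{x ≤ n ≤ x+y, n ∈ 𝒮} f(n) - X⁻¹ ∑_{X ≤ n ≤ 2X, n ∈ 𝒮} f(n)| ≤ 2^J C₄ (log X)^{-1/20}`, from
Lemma 4 (hypothesis `h4`, with its constants `C₄, X₄`) applied to the `2^J` multiplicative functions
`f g_𝒥` of Lemma 5.  This is display (17) of the paper (there with `O((log X)^{-1/20+o(1)})`).
[cite: MatomakiRadziwillAnnals2016, §9 (17)] -/
theorem lipschitz_sieved {C₄ X₄ : ℝ}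
    (h4 : ∀ f : ArithmeticFunction ℝ, f.IsMultiplicative → (∀ n, |f n| ≤ 1) →
      ∀ X x y : ℝ, X₄ ≤ X → X ≤ x → x ≤ 2 * X → X / Real.log X ^ (1 / 5 : ℝ) ≤ y → y ≤ X →
        |y⁻¹ * ∑ n ∈ Icc ⌈x⌉₊ ⌊x + y⌋₊, f n - X⁻¹ * ∑ n ∈ Icc ⌈X⌉₊ ⌊2 * X⌋₊, f n|
          ≤ C₄ / Real.log X ^ (1 / 20 : ℝ))
    (I : SieveIntervalSystem η X) (f : ArithmeticFunction ℝ) (hf : f.IsMultiplicative)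
    (hf1 : ∀ n, |f n| ≤ 1) {x y : ℝ} (hX : X₄ ≤ X) (hx : X ≤ x) (hx2 : x ≤ 2 * X)
    (hy : X / Real.log X ^ (1 / 5 : ℝ) ≤ y) (hyX : y ≤ X) :
    |y⁻¹ * ∑ n ∈ (Icc ⌈x⌉₊ ⌊x + y⌋₊).filter I.Mem, f n
        - X⁻¹ * ∑ n ∈ (Icc ⌈X⌉₊ ⌊2 * X⌋₊).filter I.Mem, f n|
      ≤ 2 ^ I.J * (C₄ / Real.log X ^ (1 / 20 : ℝ)) := by
  rw [I.sum_filter_mem_eq_real, I.sum_filter_mem_eq_real, Finset.mul_sum, Finset.mul_sum,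
    ← Finset.sum_sub_distrib]
  have hcard : (#((Icc 1 I.J).powerset) : ℝ) = 2 ^ I.J := by simp
  calc |∑ 𝒥 ∈ (Icc 1 I.J).powerset, (y⁻¹ * ((-1) ^ #𝒥 * ∑ n ∈ Icc ⌈x⌉₊ ⌊x + y⌋₊, I.g 𝒥 n * f n)
          - X⁻¹ * ((-1) ^ #𝒥 * ∑ n ∈ Icc ⌈X⌉₊ ⌊2 * X⌋₊, I.g 𝒥 n * f n))|
      ≤ ∑ 𝒥 ∈ (Icc 1 I.J).powerset, |y⁻¹ * ((-1) ^ #𝒥 * ∑ n ∈ Icc ⌈x⌉₊ ⌊x + y⌋₊, I.g 𝒥 n * f n)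
          - X⁻¹ * ((-1) ^ #𝒥 * ∑ n ∈ Icc ⌈X⌉₊ ⌊2 * X⌋₊, I.g 𝒥 n * f n)| :=
        Finset.abs_sum_le_sum_abs _ _
    _ ≤ ∑ 𝒥 ∈ (Icc 1 I.J).powerset, C₄ / Real.log X ^ (1 / 20 : ℝ) := by
        refine Finset.sum_le_sum fun 𝒥 _ => ?_
        have hmul : ((I.g 𝒥).pmul f).IsMultiplicative := (I.isMultiplicative_g 𝒥).pmul hf
        have hb : ∀ n, |((I.g 𝒥).pmul f) n| ≤ 1 := fun n => by
          rw [ArithmeticFunction.pmul_apply, abs_mul]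
          exact mul_le_one₀ (I.abs_g_le_one 𝒥 n) (abs_nonneg _) (hf1 n)
        have h := h4 _ hmul hb X x y hX hx hx2 hy hyX
        simp only [ArithmeticFunction.pmul_apply] at h
        have : y⁻¹ * ((-1) ^ #𝒥 * ∑ n ∈ Icc ⌈x⌉₊ ⌊x + y⌋₊, I.g 𝒥 n * f n)
            - X⁻¹ * ((-1) ^ #𝒥 * ∑ n ∈ Icc ⌈X⌉₊ ⌊2 * X⌋₊, I.g 𝒥 n * f n)
            = (-1) ^ #𝒥 * (y⁻¹ * ∑ n ∈ Icc ⌈x⌉₊ ⌊x + y⌋₊, I.g 𝒥 n * f n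
                - X⁻¹ * ∑ n ∈ Icc ⌈X⌉₊ ⌊2 * X⌋₊, I.g 𝒥 n * f n) := by ring
        rw [this, abs_mul, abs_pow, abs_neg, abs_one, one_pow, one_mul]
        exact h
    _ = 2 ^ I.J * (C₄ / Real.log X ^ (1 / 20 : ℝ)) := by
        rw [Finset.sum_const, nsmul_eq_mul, hcard]

/-! ### The coefficients `a_m = f(m) 1_𝒮(m) 1_{[X,2X]}(m)` fed to Lemma 14 -/

/-- `|a_m| ≤ 1` for `a_m = f(m) 1_𝒮(m) 1_{[X,2X]}(m)` (complex-valued, as Lemma 14 wants). [folklore] -/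
theorem norm_coeff_le (I : SieveIntervalSystem η X) {f : ℕ → ℝ} (hf1 : ∀ n, |f n| ≤ 1) (m : ℕ) :
    ‖(if m ∈ (Icc ⌈X⌉₊ ⌊2 * X⌋₊).filter I.Mem then (f m : ℂ) else 0)‖ ≤ 1 := by
  split_ifs
  · rw [Complex.norm_real, Real.norm_eq_abs]; exact hf1 m
  · simp

/-- The Dirichlet polynomial of `(a_m)` over any range containing `[X, 2X]` is
`F(s) = ∑_{X ≤ n ≤ 2X, n ∈ 𝒮} f(n) n^{-s}`. [folklore] -/
theorem sum_coeff_mul (I : SieveIntervalSystem η X) (f : ℕ → ℝ) (w : ℕ → ℂ) {s : Finset ℕ}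
    (hs : Icc ⌈X⌉₊ ⌊2 * X⌋₊ ⊆ s) :
    ∑ m ∈ s, (if m ∈ (Icc ⌈X⌉₊ ⌊2 * X⌋₊).filter I.Mem then (f m : ℂ) else 0) * w m
      = ∑ n ∈ (Icc ⌈X⌉₊ ⌊2 * X⌋₊).filter I.Mem, (f n : ℂ) * w n := by
  simp_rw [ite_mul, zero_mul]
  rw [← Finset.sum_filter, Finset.filter_mem_eq_inter,
    Finset.inter_eq_right.mpr ((Finset.filter_subset _ _).trans hs)]

/-- The window sums of `(a_m)` are the sieved window sums truncated to `[X, 2X]`. [folklore] -/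
theorem sum_coeff_window (I : SieveIntervalSystem η X) (f : ℕ → ℝ) (W : Finset ℕ) :
    ∑ m ∈ W, (if m ∈ (Icc ⌈X⌉₊ ⌊2 * X⌋₊).filter I.Mem then (f m : ℂ) else 0)
      = ((∑ n ∈ (W ∩ Icc ⌈X⌉₊ ⌊2 * X⌋₊).filter I.Mem, f n : ℝ) : ℂ) := by
  rw [← Finset.sum_filter]
  push_cast
  refine Finset.sum_congr ?_ fun _ _ => rfl
  ext m
  simp only [Finset.mem_filter, Finset.mem_inter]
  tauto

/-- `|a_m| ≤ 1` for the real sequence `a_m = f(m) 1_𝒮(m) 1_{[X,2X]}(m)` (as Lemma 14, in its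
faithful real-sequence rendering `MatomakiRadziwill2016_lemma14_real`, wants). [folklore] -/
theorem abs_coeffR_le (I : SieveIntervalSystem η X) {f : ℕ → ℝ} (hf1 : ∀ n, |f n| ≤ 1) (m : ℕ) :
    |(if m ∈ (Icc ⌈X⌉₊ ⌊2 * X⌋₊).filter I.Mem then f m else 0)| ≤ 1 := by
  split_ifs
  · exact hf1 m
  · simp

/-- The Dirichlet polynomial of the real sequence `(a_m)` over any range containing `[X, 2X]` is
`F(s) = ∑_{X ≤ n ≤ 2X, n ∈ 𝒮} f(n) n^{-s}`. [folklore] -/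
theorem sum_coeffR_mul (I : SieveIntervalSystem η X) (f : ℕ → ℝ) (w : ℕ → ℂ) {s : Finset ℕ}
    (hs : Icc ⌈X⌉₊ ⌊2 * X⌋₊ ⊆ s) :
    ∑ m ∈ s, ((if m ∈ (Icc ⌈X⌉₊ ⌊2 * X⌋₊).filter I.Mem then f m else 0 : ℝ) : ℂ) * w m
      = ∑ n ∈ (Icc ⌈X⌉₊ ⌊2 * X⌋₊).filter I.Mem, (f n : ℂ) * w n := by
  rw [← sum_coeff_mul I f w hs]
  refine Finset.sum_congr rfl fun m _ => ?_
  split_ifs <;> simp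

/-- The window sums of the real sequence `(a_m)` are the sieved window sums truncated to
`[X, 2X]`. [folklore] -/
theorem sum_coeffR_window (I : SieveIntervalSystem η X) (f : ℕ → ℝ) (W : Finset ℕ) :
    ∑ m ∈ W, (if m ∈ (Icc ⌈X⌉₊ ⌊2 * X⌋₊).filter I.Mem then f m else 0)
      = ∑ n ∈ (W ∩ Icc ⌈X⌉₊ ⌊2 * X⌋₊).filter I.Mem, f n := by
  rw [← Finset.sum_filter]
  refine Finset.sum_congr ?_ fun _ _ => rfl
  ext m
  simp only [Finset.mem_filter, Finset.mem_inter]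
  tauto

/-- No truncation when the window ends before `2X`. [folklore] -/
theorem window_inter_eq {x c : ℝ} (hx : X ≤ x) (hc : ⌊x + c⌋₊ ≤ ⌊2 * X⌋₊) :
    Icc ⌈x⌉₊ ⌊x + c⌋₊ ∩ Icc ⌈X⌉₊ ⌊2 * X⌋₊ = Icc ⌈x⌉₊ ⌊x + c⌋₊ :=
  Finset.inter_eq_left.mpr (Finset.Icc_subset_Icc (Nat.ceil_mono hx) hc)

/-- `#([x, x+c] ∩ ℤ) ≤ c + 1` for `x, c ≥ 0`. [folklore] -/
theorem card_window_le {x c : ℝ} (hx : 0 ≤ x) (hc : 0 ≤ c) :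
    (#(Icc ⌈x⌉₊ ⌊x + c⌋₊) : ℝ) ≤ c + 1 := by
  rw [Nat.card_Icc]
  have h1 := Nat.floor_le (add_nonneg hx hc)
  have h2 := Nat.le_ceil x
  rcases le_or_gt ⌈x⌉₊ (⌊x + c⌋₊ + 1) with h | h
  · rw [Nat.cast_sub h]; push_cast; linarith
  · rw [Nat.sub_eq_zero_of_le h.le]; simp; linarith

/-- `|∑_{n ∈ t} f(n)| ≤ c + 1` for `t ⊆ [x, x+c] ∩ ℤ` and `|f| ≤ 1`. [folklore] -/
theorem abs_sum_window_le {f : ℕ → ℝ} (hf1 : ∀ n, |f n| ≤ 1) {x c : ℝ} (hx : 0 ≤ x) (hc : 0 ≤ c)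
    {t : Finset ℕ} (ht : t ⊆ Icc ⌈x⌉₊ ⌊x + c⌋₊) : |∑ n ∈ t, f n| ≤ c + 1 := by
  calc |∑ n ∈ t, f n| ≤ ∑ n ∈ t, |f n| := Finset.abs_sum_le_sum_abs _ _
    _ ≤ ∑ n ∈ t, (1 : ℝ) := Finset.sum_le_sum fun n _ => hf1 n
    _ = #t := by simp
    _ ≤ #(Icc ⌈x⌉₊ ⌊x + c⌋₊) := by exact_mod_cast Finset.card_le_card ht
    _ ≤ c + 1 := card_window_le hx hc

/-- `‖∑_{x ≤ m ≤ x+c} a_m‖ ≤ c + 1` for `‖a‖ ≤ 1`. [folklore] -/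
theorem norm_sum_window_le {a : ℕ → ℂ} (ha : ∀ m, ‖a m‖ ≤ 1) {x c : ℝ} (hx : 0 ≤ x) (hc : 0 ≤ c) :
    ‖∑ m ∈ Icc ⌈x⌉₊ ⌊x + c⌋₊, a m‖ ≤ c + 1 := by
  calc ‖∑ m ∈ Icc ⌈x⌉₊ ⌊x + c⌋₊, a m‖ ≤ ∑ m ∈ Icc ⌈x⌉₊ ⌊x + c⌋₊, ‖a m‖ := norm_sum_le _ _
    _ ≤ ∑ m ∈ Icc ⌈x⌉₊ ⌊x + c⌋₊, (1 : ℝ) := Finset.sum_le_sum fun m _ => ha m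
    _ = #(Icc ⌈x⌉₊ ⌊x + c⌋₊) := by simp
    _ ≤ c + 1 := card_window_le hx hc

/-! ### Measure-theoretic bookkeeping -/

/-- Complex window sums `y ↦ ∑_{y ≤ n ≤ y + c} a(n)` are measurable step functions. [folklore] -/
theorem measurable_window_sum_complex (a : ℕ → ℂ) (c : ℝ) :
    Measurable (fun y : ℝ => ∑ n ∈ Icc ⌈y⌉₊ ⌊y + c⌋₊, a n) := by
  have hm : Measurable (fun y : ℝ => ((⌈y⌉₊ : ℕ), ⌊y + c⌋₊)) :=
    Nat.measurable_ceil.prodMk (Nat.measurable_floor.comp (measurable_id.add_const c))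
  exact (measurable_of_countable (fun q : ℕ × ℕ => ∑ n ∈ Icc q.1 q.2, a n)).comp hm

/-- The integrand of Lemma 14 is integrable on `(X, 2X]` (bounded by `16`, measurable). [folklore] -/
theorem integrableOn_parseval {a : ℕ → ℂ} (ha : ∀ m, ‖a m‖ ≤ 1) {h₁ h₂ X : ℝ} (hh₁ : 1 ≤ h₁)
    (hh₂ : 1 ≤ h₂) (hX : 0 ≤ X) :
    IntegrableOn (fun x : ℝ => ‖(h₁ : ℂ)⁻¹ * ∑ m ∈ Icc ⌈x⌉₊ ⌊x + h₁⌋₊, a m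
        - (h₂ : ℂ)⁻¹ * ∑ m ∈ Icc ⌈x⌉₊ ⌊x + h₂⌋₊, a m‖ ^ 2) (Set.Ioc X (2 * X)) := by
  have hm : Measurable (fun x : ℝ => ‖(h₁ : ℂ)⁻¹ * ∑ m ∈ Icc ⌈x⌉₊ ⌊x + h₁⌋₊, a m
      - (h₂ : ℂ)⁻¹ * ∑ m ∈ Icc ⌈x⌉₊ ⌊x + h₂⌋₊, a m‖ ^ 2) :=
    ((measurable_const.mul (measurable_window_sum_complex a h₁)).sub
      (measurable_const.mul (measurable_window_sum_complex a h₂))).norm.pow_const 2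
  refine Measure.integrableOn_of_bounded (M := (16 : ℝ)) measure_Ioc_lt_top.ne
    hm.aestronglyMeasurable ?_
  refine (ae_restrict_iff' measurableSet_Ioc).mpr (Filter.Eventually.of_forall fun x hx => ?_)
  have hx0 : 0 ≤ x := hX.trans hx.1.le
  rw [norm_pow, norm_norm]
  have h1 : ‖(h₁ : ℂ)⁻¹ * ∑ m ∈ Icc ⌈x⌉₊ ⌊x + h₁⌋₊, a m‖ ≤ 2 := by
    rw [norm_mul, norm_inv, Complex.norm_real, Real.norm_eq_abs, abs_of_pos (by linarith)]
    calc h₁⁻¹ * ‖∑ m ∈ Icc ⌈x⌉₊ ⌊x + h₁⌋₊, a m‖ ≤ h₁⁻¹ * (h₁ + 1) :=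
          mul_le_mul_of_nonneg_left (norm_sum_window_le ha hx0 (by linarith)) (by positivity)
      _ = 1 + h₁⁻¹ := by field_simp
      _ ≤ 2 := by have := inv_le_one_of_one_le₀ hh₁; linarith
  have h2 : ‖(h₂ : ℂ)⁻¹ * ∑ m ∈ Icc ⌈x⌉₊ ⌊x + h₂⌋₊, a m‖ ≤ 2 := by
    rw [norm_mul, norm_inv, Complex.norm_real, Real.norm_eq_abs, abs_of_pos (by linarith)]
    calc h₂⁻¹ * ‖∑ m ∈ Icc ⌈x⌉₊ ⌊x + h₂⌋₊, a m‖ ≤ h₂⁻¹ * (h₂ + 1) :=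
          mul_le_mul_of_nonneg_left (norm_sum_window_le ha hx0 (by linarith)) (by positivity)
      _ = 1 + h₂⁻¹ := by field_simp
      _ ≤ 2 := by have := inv_le_one_of_one_le₀ hh₂; linarith
  have h3 := norm_sub_le ((h₁ : ℂ)⁻¹ * ∑ m ∈ Icc ⌈x⌉₊ ⌊x + h₁⌋₊, a m)
    ((h₂ : ℂ)⁻¹ * ∑ m ∈ Icc ⌈x⌉₊ ⌊x + h₂⌋₊, a m)
  nlinarith [norm_nonneg ((h₁ : ℂ)⁻¹ * ∑ m ∈ Icc ⌈x⌉₊ ⌊x + h₁⌋₊, a m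
    - (h₂ : ℂ)⁻¹ * ∑ m ∈ Icc ⌈x⌉₊ ⌊x + h₂⌋₊, a m)]

/-- The integrand of Lemma 14 (real-sequence rendering) is integrable on `(X, 2X]`. [folklore] -/
theorem integrableOn_parseval_real {a : ℕ → ℝ} (ha : ∀ m, |a m| ≤ 1) {h₁ h₂ X : ℝ} (hh₁ : 1 ≤ h₁)
    (hh₂ : 1 ≤ h₂) (hX : 0 ≤ X) :
    IntegrableOn (fun x : ℝ => (h₁⁻¹ * ∑ m ∈ Icc ⌈x⌉₊ ⌊x + h₁⌋₊, a m
        - h₂⁻¹ * ∑ m ∈ Icc ⌈x⌉₊ ⌊x + h₂⌋₊, a m) ^ 2) (Set.Ioc X (2 * X)) := by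
  have key := integrableOn_parseval (a := fun m => (a m : ℂ))
    (fun m => by simpa using ha m) hh₁ hh₂ hX
  refine key.congr_fun (fun x _ => ?_) measurableSet_Ioc
  have hc : (((h₁⁻¹ * ∑ m ∈ Icc ⌈x⌉₊ ⌊x + h₁⌋₊, a m
      - h₂⁻¹ * ∑ m ∈ Icc ⌈x⌉₊ ⌊x + h₂⌋₊, a m : ℝ)) : ℂ)
      = (h₁ : ℂ)⁻¹ * ∑ m ∈ Icc ⌈x⌉₊ ⌊x + h₁⌋₊, (a m : ℂ)
        - (h₂ : ℂ)⁻¹ * ∑ m ∈ Icc ⌈x⌉₊ ⌊x + h₂⌋₊, (a m : ℂ) := by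
    push_cast; rfl
  simp only
  rw [← hc, Complex.norm_real, Real.norm_eq_abs, sq_abs]

/-- `∫_{(X,2X]} 1_{(c, 2X]} · 16 ≤ 16 (2X - c)` for `c ≤ 2X`. [folklore] -/
theorem setIntegral_indicator_le {X c : ℝ} (hc : c ≤ 2 * X) :
    ∫ x in Set.Ioc X (2 * X), (Set.Ioc c (2 * X)).indicator (fun _ => (16 : ℝ)) x ≤ 16 * (2 * X - c) := by
  have hint : Integrable ((Set.Ioc c (2 * X)).indicator fun _ => (16 : ℝ)) volume :=
    (integrable_indicator_iff measurableSet_Ioc).mpr (integrableOn_const measure_Ioc_lt_top.ne)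
  calc ∫ x in Set.Ioc X (2 * X), (Set.Ioc c (2 * X)).indicator (fun _ => (16 : ℝ)) x
      ≤ ∫ x, (Set.Ioc c (2 * X)).indicator (fun _ => (16 : ℝ)) x :=
        setIntegral_le_integral hint (Filter.Eventually.of_forall fun x =>
          Set.indicator_nonneg (fun _ _ => by norm_num) x)
    _ = 16 * (2 * X - c) := by
        rw [integral_indicator_const _ measurableSet_Ioc, Real.volume_real_Ioc_of_le hc, smul_eq_mul]
        ring

/-- The Dirichlet polynomials `t ↦ |∑_{n ∈ s} c_n n^{-1-it}|²` are continuous. [folklore] -/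
theorem continuous_dirichlet_normSq (s : Finset ℕ) (c : ℕ → ℂ) :
    Continuous fun t : ℝ => ‖∑ n ∈ s, c n * (n : ℂ) ^ (-(1 + (t : ℂ) * Complex.I))‖ ^ 2 := by
  refine ((continuous_finsetSum s fun n _ => ?_).norm).pow 2
  refine continuous_const.mul (Continuous.const_cpow (by fun_prop) (Or.inr fun t h0 => ?_))
  have := congrArg Complex.re h0
  simp at this

/-- `(a + b + c + d)² ≤ 4 (a² + b² + c² + d²)`. [folklore] -/
theorem sq_add_four_le (a b c d : ℝ) :
    (a + b + c + d) ^ 2 ≤ 4 * (a ^ 2 + b ^ 2 + c ^ 2 + d ^ 2) := by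
  nlinarith [sq_nonneg (a - b), sq_nonneg (a - c), sq_nonneg (a - d), sq_nonneg (b - c),
    sq_nonneg (b - d), sq_nonneg (c - d)]

/-! ### Theorem 3 from Lemma 14, Proposition 1 and Lemmas 4, 5 (§9, "Proof of Theorem 3") -/

set_option maxHeartbeats 1600000 in
-- one long bookkeeping proof (the §9 assembly of Theorem 3); about 4× the default budget is used
/-- **Matomäki–Radziwiłł 2016, Theorem 3, deduced from Lemma 14, Lemma 4 and Proposition 1**
(Lemma 5 being the proved `SieveIntervalSystem.sum_filter_mem_eq_real`), following §9 of the
paper: Lemma 14 with `a_m = f(m) 1_𝒮(m) 1_{[X,2X]}(m)`, `h₁ = h`, `h₂ = X/(log X)^{1/5}` and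
Proposition 1 (with `T = X/h` and `T ↦ 2T`) bound the mean square of `h⁻¹ S_h - h₂⁻¹ S_{h₂}` for the
window sums truncated at `2X` (the truncation matters only for `x > 2X - h_j - 1`, a set of measure
`≤ 2h₂ = 2X (log X)^{-1/5}`); the Lipschitz bound (17) (`lipschitz_sieved`, with `2^J ≪ (log X)^{1/28}`
from `four_pow_J_le`) replaces `h₂⁻¹ S_{h₂}(x)` by the long average; for `h > h₂` (17) alone
suffices. [cite: MatomakiRadziwillAnnals2016, §9, proof of Theorem 3] -/
theorem theorem3_of_prop1_real (h14 : MatomakiRadziwill2016_lemma14_real)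
    (h4 : MatomakiRadziwill2016_lemma4) (hP : MatomakiRadziwill2016_prop1) :
    MatomakiRadziwill2016_theorem3 := by
  intro η hη hη6
  obtain ⟨C₁₄, X₁₄, H14⟩ := h14
  obtain ⟨C₄, X₄, H4⟩ := h4
  obtain ⟨C_P, X_P, HP⟩ := hP η hη hη6
  refine ⟨256 + 4 * |C₁₄| + 20 * |C₁₄| * |C_P| + 4 ^ 20 * C₄ ^ 2,
    max (max X₁₄ X₄) (max X_P (Real.exp 1)), ?_⟩
  intro f hf hf1 X h hX hhX I hQh
  have hX14 : X₁₄ ≤ X := le_trans ((le_max_left _ _).trans (le_max_left _ _)) hX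
  have hX4 : X₄ ≤ X := le_trans ((le_max_right _ _).trans (le_max_left _ _)) hX
  have hXP : X_P ≤ X := le_trans ((le_max_left _ _).trans (le_max_right _ _)) hX
  have hXe : Real.exp 1 ≤ X := le_trans ((le_max_right _ _).trans (le_max_right _ _)) hX
  have hX0 : 0 < X := (Real.exp_pos 1).trans_le hXe
  have hlogX : 1 ≤ Real.log X := by
    rw [← Real.log_exp 1]; exact Real.log_le_log (Real.exp_pos 1) hXe
  set ℓ := Real.log X with hℓ
  have hℓ0 : 0 < ℓ := by linarith
  -- `h ≥ Q₁ ≥ P₁ ≥ 1`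
  have hP1 : 1 ≤ I.P 1 := I.one_le_P_one
  have hPQ : I.P 1 ≤ I.Q 1 := I.P_le_Q 1 le_rfl
  have hQ1 : 1 ≤ I.Q 1 := hP1.trans hPQ
  have hh1 : 1 ≤ h := hQ1.trans hQh
  have hh0 : 0 < h := by linarith
  -- `h₂ = X/(log X)^{1/5}`
  set h₂ := X / ℓ ^ (1 / 5 : ℝ) with hh₂
  have hℓ5 : 1 ≤ ℓ ^ (1 / 5 : ℝ) := Real.one_le_rpow hlogX (by norm_num)
  have hℓ5pos : 0 < ℓ ^ (1 / 5 : ℝ) := by linarith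
  have hh₂X : h₂ ≤ X := div_le_self hX0.le hℓ5
  have hh₂pos : 0 < h₂ := div_pos hX0 hℓ5pos
  have hh₂X' : h₂ / X = 1 / ℓ ^ (1 / 5 : ℝ) := by
    rw [hh₂]; field_simp
  -- exponent bookkeeping
  have hℓpow : ∀ a : ℝ, 1 / 50 ≤ a → 1 / ℓ ^ a ≤ 1 / ℓ ^ (1 / 50 : ℝ) := fun a ha =>
    one_div_le_one_div_of_le (Real.rpow_pos_of_pos hℓ0 _)
      (Real.rpow_le_rpow_of_exponent_le hlogX ha)
  -- the two right-hand sides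
  set BQ := Real.log (I.Q 1) ^ (1 / 3 : ℝ) / I.P 1 ^ (1 / 6 - η) + 1 / ℓ ^ (1 / 50 : ℝ) with hBQ
  set Bh := Real.log h ^ (1 / 3 : ℝ) / I.P 1 ^ (1 / 6 - η) + 1 / ℓ ^ (1 / 50 : ℝ) with hBh
  have hP16 : 0 < I.P 1 ^ (1 / 6 - η) := Real.rpow_pos_of_pos (by linarith) _
  have hlogQ3 : 0 ≤ Real.log (I.Q 1) ^ (1 / 3 : ℝ) := Real.rpow_nonneg (Real.log_nonneg hQ1) _
  have hlogh3 : 0 ≤ Real.log h ^ (1 / 3 : ℝ) := Real.rpow_nonneg (Real.log_nonneg hh1) _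
  have hℓ50 : 0 ≤ 1 / ℓ ^ (1 / 50 : ℝ) := by positivity
  have hBQ0 : 0 ≤ BQ := add_nonneg (div_nonneg hlogQ3 hP16.le) hℓ50
  have hBQh : BQ ≤ Bh := by
    have h1 : Real.log (I.Q 1) ^ (1 / 3 : ℝ) ≤ Real.log h ^ (1 / 3 : ℝ) :=
      Real.rpow_le_rpow (Real.log_nonneg hQ1) (Real.log_le_log (by linarith) hQh) (by norm_num)
    have := div_le_div_of_nonneg_right h1 hP16.le
    rw [hBQ, hBh]; linarith
  have hBh1 : 1 / ℓ ^ (1 / 50 : ℝ) ≤ Bh := le_add_of_nonneg_left (div_nonneg hlogh3 hP16.le)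
  have hBh0 : 0 ≤ Bh := hBQ0.trans hBQh
  -- the `J` bound and the Lipschitz constant `M₄ = 2^J C₄ (log X)^{-1/20}`
  have hJ := four_pow_J_le I hη (by linarith) hlogX
  set M₄ := 2 ^ I.J * (C₄ / ℓ ^ (1 / 20 : ℝ)) with hM₄
  have hM₄sq : M₄ ^ 2 ≤ 4 ^ 19 * C₄ ^ 2 * (1 / ℓ ^ (1 / 50 : ℝ)) := by
    have h1 : M₄ ^ 2 = 4 ^ I.J * C₄ ^ 2 * (1 / ℓ ^ (1 / 10 : ℝ)) := by
      have h4 : (4 : ℝ) ^ I.J = (2 ^ I.J) ^ 2 := by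
        rw [← pow_mul, mul_comm, pow_mul]; norm_num
      have h20 : (ℓ ^ (1 / 20 : ℝ)) ^ 2 = ℓ ^ (1 / 10 : ℝ) := by
        rw [← Real.rpow_natCast, ← Real.rpow_mul hℓ0.le]; norm_num
      rw [hM₄, h4, ← h20]
      field_simp
    have h2 : (4 : ℝ) ^ I.J * (1 / ℓ ^ (1 / 10 : ℝ)) ≤ 4 ^ 19 * (1 / ℓ ^ (1 / 50 : ℝ)) := by
      calc (4 : ℝ) ^ I.J * (1 / ℓ ^ (1 / 10 : ℝ))
          ≤ 4 ^ 19 * ℓ ^ (1 / 14 : ℝ) * (1 / ℓ ^ (1 / 10 : ℝ)) :=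
            mul_le_mul_of_nonneg_right hJ (by positivity)
        _ = 4 ^ 19 * (1 / ℓ ^ (1 / 35 : ℝ)) := by
            rw [mul_assoc]
            congr 1
            rw [mul_one_div, div_eq_div_iff (Real.rpow_pos_of_pos hℓ0 _).ne'
              (Real.rpow_pos_of_pos hℓ0 _).ne', one_mul, ← Real.rpow_add hℓ0]
            norm_num
        _ ≤ 4 ^ 19 * (1 / ℓ ^ (1 / 50 : ℝ)) :=
            mul_le_mul_of_nonneg_left (hℓpow _ (by norm_num)) (by positivity)
    rw [h1]
    calc (4 : ℝ) ^ I.J * C₄ ^ 2 * (1 / ℓ ^ (1 / 10 : ℝ))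
        = C₄ ^ 2 * ((4 : ℝ) ^ I.J * (1 / ℓ ^ (1 / 10 : ℝ))) := by ring
      _ ≤ C₄ ^ 2 * (4 ^ 19 * (1 / ℓ ^ (1 / 50 : ℝ))) := mul_le_mul_of_nonneg_left h2 (sq_nonneg _)
      _ = 4 ^ 19 * C₄ ^ 2 * (1 / ℓ ^ (1 / 50 : ℝ)) := by ring
  have hM₄Bh : M₄ ^ 2 ≤ 4 ^ 19 * C₄ ^ 2 * Bh :=
    hM₄sq.trans (mul_le_mul_of_nonneg_left hBh1 (by positivity))
  -- (17): the Lipschitz bound for the sieved sums, `y ∈ [h₂, X]`, `x ∈ [X, 2X]`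
  have hLip : ∀ x y : ℝ, X ≤ x → x ≤ 2 * X → h₂ ≤ y → y ≤ X →
      |y⁻¹ * ∑ n ∈ (Icc ⌈x⌉₊ ⌊x + y⌋₊).filter I.Mem, f n
          - X⁻¹ * ∑ n ∈ (Icc ⌈X⌉₊ ⌊2 * X⌋₊).filter I.Mem, f n| ≤ M₄ := fun x y hx hx2 hy hyX =>
    lipschitz_sieved H4 I f hf hf1 hX4 hx hx2 hy hyX
  -- the constant is at least each of its pieces
  set C := 256 + 4 * |C₁₄| + 20 * |C₁₄| * |C_P| + 4 ^ 20 * C₄ ^ 2 with hC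
  have hC19 : 4 ^ 19 * C₄ ^ 2 * Bh ≤ C * Bh := by
    apply mul_le_mul_of_nonneg_right _ hBh0
    rw [hC]
    nlinarith [abs_nonneg C₁₄, abs_nonneg C_P, sq_nonneg C₄, mul_nonneg (abs_nonneg C₁₄) (abs_nonneg C_P)]
  set B := X⁻¹ * ∑ n ∈ (Icc ⌈X⌉₊ ⌊2 * X⌋₊).filter I.Mem, f n with hB
  change X⁻¹ * ∫ x in X..2 * X, (h⁻¹ * ∑ n ∈ (Icc ⌈x⌉₊ ⌊x + h⌋₊).filter I.Mem, f n - B) ^ 2 ≤ C * Bh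
  rcases le_or_gt h h₂ with hcase | hcase
  · /- **Case `h ≤ h₂`.** -/
    obtain ⟨a, ha⟩ : ∃ a : ℕ → ℝ,
        a = fun m => if m ∈ (Icc ⌈X⌉₊ ⌊2 * X⌋₊).filter I.Mem then f m else 0 := ⟨_, rfl⟩
    have ha1 : ∀ m, |a m| ≤ 1 := fun m => by rw [ha]; exact abs_coeffR_le I hf1 m
    -- the Dirichlet polynomial `F(1+it)` of Proposition 1
    set F : ℝ → ℂ := fun t => ∑ n ∈ (Icc ⌈X⌉₊ ⌊2 * X⌋₊).filter I.Mem,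
      (f n : ℂ) * (n : ℂ) ^ (-(1 + (t : ℂ) * Complex.I)) with hF
    have hAF : ∀ t : ℝ, ∑ m ∈ Icc ⌈X⌉₊ ⌊4 * X⌋₊, (a m : ℂ) * (m : ℂ) ^ (-(1 + (t : ℂ) * Complex.I))
        = F t := fun t => by
      rw [ha]
      exact sum_coeffR_mul I f _ (Finset.Icc_subset_Icc le_rfl (Nat.floor_mono (by linarith)))
    have hFcont : Continuous fun t : ℝ => ‖F t‖ ^ 2 := continuous_dirichlet_normSq _ _
    have hFnn : ∀ t, 0 ≤ ‖F t‖ ^ 2 := fun t => sq_nonneg _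
    -- Proposition 1
    have hT₀ : ℓ ^ (1 / 15 : ℝ) ≤ X / h := by
      calc ℓ ^ (1 / 15 : ℝ) ≤ ℓ ^ (1 / 5 : ℝ) :=
            Real.rpow_le_rpow_of_exponent_le hlogX (by norm_num)
        _ = X / h₂ := by rw [hh₂]; field_simp
        _ ≤ X / h := div_le_div_of_nonneg_left hX0.le hh0 hcase
    have hXh0 : 0 < X / h := div_pos hX0 hh0
    have hProp : ∀ T : ℝ, ℓ ^ (1 / 15 : ℝ) ≤ T →
        ∫ t in ℓ ^ (1 / 15 : ℝ)..T, ‖F t‖ ^ 2 ≤ |C_P| * (T / (X / I.Q 1) + 1) * BQ := by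
      intro T hT
      have h := HP f hf hf1 X hXP I T hT
      refine h.trans ?_
      have hpos : 0 ≤ T / (X / I.Q 1) + 1 := by
        have : 0 ≤ T := le_trans (by positivity) hT
        positivity
      gcongr
      exact le_abs_self _
    -- the two Dirichlet terms of Lemma 14
    have hD1 : ∫ t in ℓ ^ (1 / 15 : ℝ)..X / h, ‖F t‖ ^ 2 ≤ 2 * |C_P| * BQ := by
      refine (hProp _ hT₀).trans ?_
      have : X / h / (X / I.Q 1) ≤ 1 := by
        rw [div_le_one (div_pos hX0 (by linarith))]
        exact div_le_div_of_nonneg_left hX0.le (by linarith) hQh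
      have : X / h / (X / I.Q 1) + 1 ≤ 2 := by linarith
      calc |C_P| * (X / h / (X / I.Q 1) + 1) * BQ ≤ |C_P| * 2 * BQ := by gcongr
        _ = 2 * |C_P| * BQ := by ring
    have hD2 : ∀ T : Set.Ici (X / h),
        (X / h) / (T : ℝ) * ∫ t in (T : ℝ)..2 * T, ‖F t‖ ^ 2 ≤ 3 * |C_P| * BQ := by
      intro T
      have hT : X / h ≤ T := T.2
      have hT0 : 0 < (T : ℝ) := hXh0.trans_le hT
      have h1 : ∫ t in (T : ℝ)..2 * T, ‖F t‖ ^ 2 ≤ ∫ t in ℓ ^ (1 / 15 : ℝ)..2 * T, ‖F t‖ ^ 2 :=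
        intervalIntegral.integral_mono_interval (hT₀.trans hT) (by linarith) le_rfl
          (Filter.Eventually.of_forall hFnn) (hFcont.intervalIntegrable _ _)
      have h2 := hProp (2 * T) (by linarith)
      have h3 : (X / h) / (T : ℝ) * (|C_P| * (2 * T / (X / I.Q 1) + 1) * BQ)
          = |C_P| * BQ * (2 * (I.Q 1 / h) + (X / h) / T) := by
        field_simp
      have h4 : I.Q 1 / h ≤ 1 := by rwa [div_le_one hh0]
      have h5 : (X / h) / (T : ℝ) ≤ 1 := by rwa [div_le_one hT0]
      calc (X / h) / (T : ℝ) * ∫ t in (T : ℝ)..2 * T, ‖F t‖ ^ 2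
          ≤ (X / h) / (T : ℝ) * (|C_P| * (2 * T / (X / I.Q 1) + 1) * BQ) :=
            mul_le_mul_of_nonneg_left (h1.trans h2) (by positivity)
        _ = |C_P| * BQ * (2 * (I.Q 1 / h) + (X / h) / T) := h3
        _ ≤ |C_P| * BQ * 3 := by
            apply mul_le_mul_of_nonneg_left _ (by positivity)
            linarith
        _ = 3 * |C_P| * BQ := by ring
    -- Lemma 14
    have h14 := H14 a ha1 X h hX14 hh1 hcase
    simp only [hAF] at h14
    rw [← hℓ] at h14
    haveI : Nonempty (Set.Ici (X / h)) := ⟨⟨X / h, Set.mem_Ici.mpr le_rfl⟩⟩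
    have hsup : ⨆ T : Set.Ici (X / h), (X / h) / (T : ℝ) * ∫ t in (T : ℝ)..2 * T, ‖F t‖ ^ 2
        ≤ 3 * |C_P| * BQ := ciSup_le hD2
    have hsup0 : 0 ≤ ⨆ T : Set.Ici (X / h), (X / h) / (T : ℝ) * ∫ t in (T : ℝ)..2 * T, ‖F t‖ ^ 2 := by
      refine Real.iSup_nonneg fun T => ?_
      have hT0 : 0 < (T : ℝ) := hXh0.trans_le T.2
      exact mul_nonneg (by positivity)
        (intervalIntegral.integral_nonneg (by linarith) fun t _ => hFnn t)
    have hint0 : 0 ≤ ∫ t in ℓ ^ (1 / 15 : ℝ)..X / h, ‖F t‖ ^ 2 :=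
      intervalIntegral.integral_nonneg hT₀ fun t _ => hFnn t
    -- the mean square of `T₂ = h⁻¹ S'_h - h₂⁻¹ S'_{h₂}` (truncated windows)
    set T2sq : ℝ → ℝ := fun x => (h⁻¹ * ∑ m ∈ Icc ⌈x⌉₊ ⌊x + h⌋₊, a m
        - h₂⁻¹ * ∑ m ∈ Icc ⌈x⌉₊ ⌊x + h₂⌋₊, a m) ^ 2 with hT2sq
    have h14' : X⁻¹ * ∫ x in X..2 * X, T2sq x ≤ |C₁₄| * (1 / ℓ ^ (1 / 50 : ℝ) + 5 * |C_P| * Bh) := by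
      -- (pure inequality bookkeeping, phrased so that the three terms of Lemma 14 are found by
      -- unification rather than by syntactic matching)
      have aux : ∀ c A I₁ I₂ A' V₁ V₂ : ℝ, 0 ≤ A → 0 ≤ I₁ → 0 ≤ I₂ → A ≤ A' → I₁ ≤ V₁ → I₂ ≤ V₂ →
          c * (A + I₁ + I₂) ≤ |c| * (A' + V₁ + V₂) := by
        intro c A I₁ I₂ A' V₁ V₂ hA hI₁ hI₂ hA' hV₁ hV₂
        calc c * (A + I₁ + I₂) ≤ |c| * (A + I₁ + I₂) :=
              mul_le_mul_of_nonneg_right (le_abs_self _) (by linarith)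
          _ ≤ |c| * (A' + V₁ + V₂) := mul_le_mul_of_nonneg_left (by linarith) (abs_nonneg _)
      have hℓ215 : 0 ≤ 1 / ℓ ^ (2 / 15 : ℝ) := by positivity
      have hℓ215' : 1 / ℓ ^ (2 / 15 : ℝ) ≤ 1 / ℓ ^ (1 / 50 : ℝ) := hℓpow _ (by norm_num)
      refine (h14.trans (aux C₁₄ _ _ _ _ _ _ hℓ215 hint0 hsup0 hℓ215' hD1 hsup)).trans ?_
      have hCP0 : 0 ≤ |C_P| := abs_nonneg _
      have hBB : |C_P| * BQ ≤ |C_P| * Bh := mul_le_mul_of_nonneg_left hBQh hCP0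
      exact mul_le_mul_of_nonneg_left (by linarith) (abs_nonneg _)
    -- pointwise decomposition on `(X, 2X]`
    obtain ⟨S, hS⟩ : ∃ S : ℝ → ℝ → ℝ,
        ∀ c x, S c x = ∑ n ∈ (Icc ⌈x⌉₊ ⌊x + c⌋₊).filter I.Mem, f n := ⟨_, fun _ _ => rfl⟩
    obtain ⟨S', hS'⟩ : ∃ S' : ℝ → ℝ → ℝ,
        ∀ c x, S' c x = ∑ n ∈ (Icc ⌈x⌉₊ ⌊x + c⌋₊ ∩ Icc ⌈X⌉₊ ⌊2 * X⌋₊).filter I.Mem, f n :=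
      ⟨_, fun _ _ => rfl⟩
    have hT2eq : ∀ x, T2sq x = (h⁻¹ * S' h x - h₂⁻¹ * S' h₂ x) ^ 2 := by
      intro x
      simp only [hT2sq, ha, sum_coeffR_window, hS']
    -- sizes of the four pieces
    have hSb : ∀ c x, 0 ≤ c → X ≤ x → |S c x| ≤ c + 1 := fun c x hc hx => by
      rw [hS]
      exact abs_sum_window_le hf1 (hX0.le.trans hx) hc (Finset.filter_subset _ _)
    have hS'b : ∀ c x, 0 ≤ c → X ≤ x → |S' c x| ≤ c + 1 := fun c x hc hx => by
      rw [hS']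
      exact abs_sum_window_le hf1 (hX0.le.trans hx) hc
        ((Finset.filter_subset _ _).trans (Finset.inter_subset_left))
    have hSS' : ∀ c x, X ≤ x → x ≤ 2 * X - c - 1 → S' c x = S c x := by
      intro c x hx hxc
      rw [hS, hS', window_inter_eq hx (Nat.floor_mono (by linarith))]
    have htrunc : ∀ c x, 1 ≤ c → X ≤ x → x ≤ 2 * X →
        (c⁻¹ * S c x - c⁻¹ * S' c x) ^ 2
          ≤ (Set.Ioc (2 * X - c - 1) (2 * X)).indicator (fun _ => (16 : ℝ)) x := by
      intro c x hc hx hx2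
      by_cases hxc : x ≤ 2 * X - c - 1
      · rw [hSS' c x hx hxc, sub_self]
        simpa using Set.indicator_nonneg (fun _ _ => by norm_num) x
      · push Not at hxc
        rw [Set.indicator_of_mem (Set.mem_Ioc.mpr ⟨hxc, hx2⟩)]
        have h1 := hSb c x (by linarith) hx
        have h2 := hS'b c x (by linarith) hx
        have hc0 : 0 < c := by linarith
        have h3 : |c⁻¹ * S c x - c⁻¹ * S' c x| ≤ 4 := by
          rw [← mul_sub, abs_mul, abs_of_pos (inv_pos.mpr hc0)]
          calc c⁻¹ * |S c x - S' c x| ≤ c⁻¹ * (2 * (c + 1)) := by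
                apply mul_le_mul_of_nonneg_left _ (inv_pos.mpr hc0).le
                have := abs_sub (S c x) (S' c x); linarith
            _ = 2 + 2 * c⁻¹ := by field_simp
            _ ≤ 4 := by have := inv_le_one_of_one_le₀ hc; linarith
        nlinarith [abs_nonneg (c⁻¹ * S c x - c⁻¹ * S' c x), sq_abs (c⁻¹ * S c x - c⁻¹ * S' c x)]
    -- the dominating function
    obtain ⟨G, hG⟩ : ∃ G : ℝ → ℝ, G = fun x =>
        4 * ((Set.Ioc (2 * X - h - 1) (2 * X)).indicator (fun _ => (16 : ℝ)) x
        + T2sq x + (Set.Ioc (2 * X - h₂ - 1) (2 * X)).indicator (fun _ => (16 : ℝ)) x + M₄ ^ 2) :=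
      ⟨_, rfl⟩
    have hdom : ∀ x ∈ Set.Ioc X (2 * X), (h⁻¹ * S h x - B) ^ 2 ≤ G x := by
      intro x hx
      have hx1 : X ≤ x := hx.1.le
      have e : h⁻¹ * S h x - B = (h⁻¹ * S h x - h⁻¹ * S' h x) + (h⁻¹ * S' h x - h₂⁻¹ * S' h₂ x)
          + (h₂⁻¹ * S' h₂ x - h₂⁻¹ * S h₂ x) + (h₂⁻¹ * S h₂ x - B) := by ring
      rw [e]
      refine (sq_add_four_le _ _ _ _).trans ?_
      simp only [hG]
      gcongr 4 * (?_ + ?_ + ?_ + ?_)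
      · exact htrunc h x hh1 hx1 hx.2
      · rw [hT2eq]
      · rw [show (h₂⁻¹ * S' h₂ x - h₂⁻¹ * S h₂ x) ^ 2 = (h₂⁻¹ * S h₂ x - h₂⁻¹ * S' h₂ x) ^ 2 by ring]
        exact htrunc h₂ x (hh1.trans hcase) hx1 hx.2
      · have := hLip x h₂ hx1 hx.2 le_rfl hh₂X
        rw [hS, hB]
        calc (h₂⁻¹ * ∑ n ∈ (Icc ⌈x⌉₊ ⌊x + h₂⌋₊).filter I.Mem, f n
              - X⁻¹ * ∑ n ∈ (Icc ⌈X⌉₊ ⌊2 * X⌋₊).filter I.Mem, f n) ^ 2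
            = |h₂⁻¹ * ∑ n ∈ (Icc ⌈x⌉₊ ⌊x + h₂⌋₊).filter I.Mem, f n
              - X⁻¹ * ∑ n ∈ (Icc ⌈X⌉₊ ⌊2 * X⌋₊).filter I.Mem, f n| ^ 2 := (sq_abs _).symm
          _ ≤ M₄ ^ 2 := pow_le_pow_left₀ (abs_nonneg _) this 2
    -- integrability of the dominating function
    have hInd : ∀ c : ℝ, IntegrableOn (fun x => (Set.Ioc (2 * X - c - 1) (2 * X)).indicator
        (fun _ => (16 : ℝ)) x) (Set.Ioc X (2 * X)) := fun c =>
      ((integrable_indicator_iff measurableSet_Ioc).mpr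
        (integrableOn_const measure_Ioc_lt_top.ne)).integrableOn
    have hT2int : IntegrableOn T2sq (Set.Ioc X (2 * X)) :=
      integrableOn_parseval_real ha1 hh1 (hh1.trans hcase) hX0.le
    have hconst : IntegrableOn (fun _ : ℝ => M₄ ^ 2) (Set.Ioc X (2 * X)) :=
      integrableOn_const measure_Ioc_lt_top.ne
    have i1 : IntegrableOn (fun x => (Set.Ioc (2 * X - h - 1) (2 * X)).indicator (fun _ => (16 : ℝ)) x
        + T2sq x) (Set.Ioc X (2 * X)) := (hInd h).add hT2int
    have i2 : IntegrableOn (fun x => (Set.Ioc (2 * X - h - 1) (2 * X)).indicator (fun _ => (16 : ℝ)) x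
        + T2sq x + (Set.Ioc (2 * X - h₂ - 1) (2 * X)).indicator (fun _ => (16 : ℝ)) x)
        (Set.Ioc X (2 * X)) := i1.add (hInd h₂)
    have i3 : IntegrableOn (fun x => (Set.Ioc (2 * X - h - 1) (2 * X)).indicator (fun _ => (16 : ℝ)) x
        + T2sq x + (Set.Ioc (2 * X - h₂ - 1) (2 * X)).indicator (fun _ => (16 : ℝ)) x + M₄ ^ 2)
        (Set.Ioc X (2 * X)) := i2.add hconst
    have hGint : IntegrableOn G (Set.Ioc X (2 * X)) := by
      rw [hG]
      exact i3.const_mul 4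
    -- integrate
    have hmono : ∫ x in Set.Ioc X (2 * X), (h⁻¹ * S h x - B) ^ 2 ≤ ∫ x in Set.Ioc X (2 * X), G x :=
      integral_mono_of_nonneg (Filter.Eventually.of_forall fun x => sq_nonneg _) hGint
        ((ae_restrict_iff' measurableSet_Ioc).mpr (Filter.Eventually.of_forall hdom))
    have hGval : ∫ x in Set.Ioc X (2 * X), G x
        = 4 * ((∫ x in Set.Ioc X (2 * X), (Set.Ioc (2 * X - h - 1) (2 * X)).indicator (fun _ => (16 : ℝ)) x)
          + (∫ x in Set.Ioc X (2 * X), T2sq x)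
          + (∫ x in Set.Ioc X (2 * X), (Set.Ioc (2 * X - h₂ - 1) (2 * X)).indicator (fun _ => (16 : ℝ)) x)
          + M₄ ^ 2 * X) := by
      simp only [hG]
      rw [integral_const_mul, integral_add i2 hconst, integral_add i1 (hInd h₂),
        integral_add (hInd h) hT2int, setIntegral_const, Real.volume_real_Ioc_of_le (by linarith),
        smul_eq_mul]
      ring
    have hI1 := setIntegral_indicator_le (X := X) (c := 2 * X - h - 1) (by linarith)
    have hI2 := setIntegral_indicator_le (X := X) (c := 2 * X - h₂ - 1) (by linarith)
    have hT2' : ∫ x in Set.Ioc X (2 * X), T2sq x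
        ≤ X * (|C₁₄| * (1 / ℓ ^ (1 / 50 : ℝ) + 5 * |C_P| * Bh)) := by
      rw [intervalIntegral.integral_of_le (by linarith)] at h14'
      rwa [← div_le_iff₀' hX0, div_eq_inv_mul]
    rw [intervalIntegral.integral_of_le (by linarith)]
    -- final bookkeeping
    have hhX2 : h + 1 ≤ 2 * h₂ := by linarith
    have hh₂2 : h₂ + 1 ≤ 2 * h₂ := by linarith
    have hkey : X⁻¹ * ∫ x in Set.Ioc X (2 * X), G x
        ≤ 256 * (h₂ / X) + 4 * (|C₁₄| * (1 / ℓ ^ (1 / 50 : ℝ) + 5 * |C_P| * Bh)) + 4 * M₄ ^ 2 := by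
      rw [hGval]
      have e1 : X⁻¹ * (4 * ((∫ x in Set.Ioc X (2 * X), (Set.Ioc (2 * X - h - 1) (2 * X)).indicator (fun _ => (16 : ℝ)) x)
          + (∫ x in Set.Ioc X (2 * X), T2sq x)
          + (∫ x in Set.Ioc X (2 * X), (Set.Ioc (2 * X - h₂ - 1) (2 * X)).indicator (fun _ => (16 : ℝ)) x)
          + M₄ ^ 2 * X))
          = 4 * (X⁻¹ * (∫ x in Set.Ioc X (2 * X), (Set.Ioc (2 * X - h - 1) (2 * X)).indicator (fun _ => (16 : ℝ)) x)
            + X⁻¹ * (∫ x in Set.Ioc X (2 * X), T2sq x)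
            + X⁻¹ * (∫ x in Set.Ioc X (2 * X), (Set.Ioc (2 * X - h₂ - 1) (2 * X)).indicator (fun _ => (16 : ℝ)) x)
            + M₄ ^ 2) := by
        field_simp
      rw [e1]
      have f1 : X⁻¹ * (∫ x in Set.Ioc X (2 * X), (Set.Ioc (2 * X - h - 1) (2 * X)).indicator (fun _ => (16 : ℝ)) x)
          ≤ 32 * (h₂ / X) := by
        calc X⁻¹ * (∫ x in Set.Ioc X (2 * X), (Set.Ioc (2 * X - h - 1) (2 * X)).indicator (fun _ => (16 : ℝ)) x)
            ≤ X⁻¹ * (16 * (2 * X - (2 * X - h - 1))) :=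
              mul_le_mul_of_nonneg_left hI1 (inv_pos.mpr hX0).le
          _ = 16 * (h + 1) / X := by field_simp; ring
          _ ≤ 16 * (2 * h₂) / X := by gcongr
          _ = 32 * (h₂ / X) := by ring
      have f2 : X⁻¹ * (∫ x in Set.Ioc X (2 * X), T2sq x)
          ≤ |C₁₄| * (1 / ℓ ^ (1 / 50 : ℝ) + 5 * |C_P| * Bh) := by
        calc X⁻¹ * (∫ x in Set.Ioc X (2 * X), T2sq x)
            ≤ X⁻¹ * (X * (|C₁₄| * (1 / ℓ ^ (1 / 50 : ℝ) + 5 * |C_P| * Bh))) :=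
              mul_le_mul_of_nonneg_left hT2' (inv_pos.mpr hX0).le
          _ = |C₁₄| * (1 / ℓ ^ (1 / 50 : ℝ) + 5 * |C_P| * Bh) := by field_simp
      have f3 : X⁻¹ * (∫ x in Set.Ioc X (2 * X), (Set.Ioc (2 * X - h₂ - 1) (2 * X)).indicator (fun _ => (16 : ℝ)) x)
          ≤ 32 * (h₂ / X) := by
        calc X⁻¹ * (∫ x in Set.Ioc X (2 * X), (Set.Ioc (2 * X - h₂ - 1) (2 * X)).indicator (fun _ => (16 : ℝ)) x)
            ≤ X⁻¹ * (16 * (2 * X - (2 * X - h₂ - 1))) :=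
              mul_le_mul_of_nonneg_left hI2 (inv_pos.mpr hX0).le
          _ = 16 * (h₂ + 1) / X := by field_simp; ring
          _ ≤ 16 * (2 * h₂) / X := by gcongr
          _ = 32 * (h₂ / X) := by ring
      linarith
    rw [hh₂X'] at hkey
    have hℓ5' : 1 / ℓ ^ (1 / 5 : ℝ) ≤ Bh := (hℓpow _ (by norm_num)).trans hBh1
    have hgoal : (fun x => (h⁻¹ * ∑ n ∈ (Icc ⌈x⌉₊ ⌊x + h⌋₊).filter I.Mem, f n - B) ^ 2)
        = fun x => (h⁻¹ * S h x - B) ^ 2 := by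
      funext x; rw [hS]
    rw [hgoal]
    calc X⁻¹ * ∫ x in Set.Ioc X (2 * X), (h⁻¹ * S h x - B) ^ 2
        ≤ X⁻¹ * ∫ x in Set.Ioc X (2 * X), G x :=
          mul_le_mul_of_nonneg_left hmono (inv_pos.mpr hX0).le
      _ ≤ 256 * (1 / ℓ ^ (1 / 5 : ℝ)) + 4 * (|C₁₄| * (1 / ℓ ^ (1 / 50 : ℝ) + 5 * |C_P| * Bh))
          + 4 * M₄ ^ 2 := hkey
      _ ≤ 256 * Bh + 4 * (|C₁₄| * (Bh + 5 * |C_P| * Bh)) + 4 * (4 ^ 19 * C₄ ^ 2 * Bh) := by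
          gcongr
      _ = C * Bh := by rw [hC]; ring
  · /- **Case `h > h₂`**: (17) alone. -/
    have hpt : ∀ x ∈ Set.uIoc X (2 * X),
        ‖(h⁻¹ * ∑ n ∈ (Icc ⌈x⌉₊ ⌊x + h⌋₊).filter I.Mem, f n - B) ^ 2‖ ≤ M₄ ^ 2 := by
      intro x hx
      rw [Set.uIoc_of_le (by linarith)] at hx
      rw [Real.norm_eq_abs, abs_pow, sq_abs, ← sq_abs]
      exact pow_le_pow_left₀ (abs_nonneg _) (hLip x h hx.1.le hx.2 hcase.le hhX) 2
    have hI := intervalIntegral.norm_integral_le_of_norm_le_const hpt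
    rw [Real.norm_eq_abs, show 2 * X - X = X by ring, abs_of_pos hX0] at hI
    have hI' := (le_abs_self _).trans hI
    calc X⁻¹ * ∫ x in X..2 * X, (h⁻¹ * ∑ n ∈ (Icc ⌈x⌉₊ ⌊x + h⌋₊).filter I.Mem, f n - B) ^ 2
        ≤ X⁻¹ * (M₄ ^ 2 * X) := mul_le_mul_of_nonneg_left hI' (inv_pos.mpr hX0).le
      _ = M₄ ^ 2 := by field_simp
      _ ≤ 4 ^ 19 * C₄ ^ 2 * Bh := hM₄Bh
      _ ≤ C * Bh := hC19

/-- **Deprecated (vacuous: the hypothesis `MatomakiRadziwill2016_lemma14_parseval` is refuted,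
`MatomakiRadziwill2016_lemma14_parseval_false`; use `theorem3_of_prop1_real`).**  Theorem 3 from the
complex-sequence rendering `MatomakiRadziwill2016_lemma14_parseval` of Lemma 14 (that rendering
over-states the lemma, see `MatomakiRadziwill2016_lemma14_real`, and implies the faithful
real-sequence one; kept for append-only reasons).
[cite: MatomakiRadziwillAnnals2016, §9, proof of Theorem 3] -/
@[deprecated theorem3_of_prop1_real "vacuous: the hypothesis MatomakiRadziwill2016_lemma14_parseval is refuted (MatomakiRadziwill2016_lemma14_parseval_false); use theorem3_of_prop1_real with MatomakiRadziwill2016_lemma14_real_holds" (since := "2026-08-15")]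
theorem theorem3_of_prop1 (h14 : MatomakiRadziwill2016_lemma14_parseval) (h4 : MatomakiRadziwill2016_lemma4)
    (hP : MatomakiRadziwill2016_prop1) : MatomakiRadziwill2016_theorem3 :=
  theorem3_of_prop1_real (MatomakiRadziwill2016_lemma14_real_of_parseval h14) h4 hP

end MatomakiRadziwillThm3

/-- **Matomäki–Radziwiłł 2016, Theorem 3 from Lemma 14, Lemma 4 and Proposition 1** (paper-facing
name; §9 of the paper, proved here — Lemma 5 is the proved `MatomakiRadziwill2016_lemma5`; Lemma 14
enters through its faithful real-sequence rendering `MatomakiRadziwill2016_lemma14_real`).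
[cite: MatomakiRadziwillAnnals2016, §9, proof of Theorem 3] -/
theorem MatomakiRadziwill2016_theorem3_of_prop1_real (h14 : MatomakiRadziwill2016_lemma14_real)
    (h4 : MatomakiRadziwill2016_lemma4) (hP : MatomakiRadziwill2016_prop1) :
    MatomakiRadziwill2016_theorem3 :=
  MatomakiRadziwillThm3.theorem3_of_prop1_real h14 h4 hP

/-- **Deprecated (vacuous: the hypothesis `MatomakiRadziwill2016_lemma14_parseval` is refuted,
`MatomakiRadziwill2016_lemma14_parseval_false`; use `MatomakiRadziwill2016_theorem3_of_prop1_real`,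
e.g. with the proved `MatomakiRadziwill2016_lemma14_real_holds`).**  Theorem 3 from the
complex-sequence rendering `MatomakiRadziwill2016_lemma14_parseval` of Lemma 14, Lemma 4 and
Proposition 1 (compatibility form of `MatomakiRadziwill2016_theorem3_of_prop1_real`; the complex
rendering over-states Lemma 14 and implies the real one; kept for append-only reasons).
[cite: MatomakiRadziwillAnnals2016, §9, proof of Theorem 3] -/
@[deprecated MatomakiRadziwill2016_theorem3_of_prop1_real "vacuous: the hypothesis MatomakiRadziwill2016_lemma14_parseval is refuted (MatomakiRadziwill2016_lemma14_parseval_false); use MatomakiRadziwill2016_theorem3_of_prop1_real with MatomakiRadziwill2016_lemma14_real_holds" (since := "2026-08-15")]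
theorem MatomakiRadziwill2016_theorem3_of_prop1 (h14 : MatomakiRadziwill2016_lemma14_parseval)
    (h4 : MatomakiRadziwill2016_lemma4) (hP : MatomakiRadziwill2016_prop1) :
    MatomakiRadziwill2016_theorem3 :=
  MatomakiRadziwillThm3.theorem3_of_prop1 h14 h4 hP

end Literature.NumberTheory.Sieve
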